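import Summits.Ventures.HSemireg.Pad4TowerB1OddBoostBlind

/-!
# Cruxes ∕ BlochSeedDiscOne — LINE 7 (negation lens g7): «UNSAT ROWS DESCEND» (kernel) + the typed LINE N-MENU LAW `(NM_h)` (target)

HONEST FRAMING. Lens seat `plan-lens-HodgeAV-negation` g7 (director-hodge req-36), crux of record stmt-HodgeConjecture-18881
`BlochSeedDiscOne` (skeleton `Lines/birth.lean` 814a6a70c14e831a UNTOUCHED). NOTHING HERE SAYS THAT HC ∕ HC_CM ∕ HC_AV ∕ H2 ∕ 18881 HOLDS OR
FAILS (HC_CM is a displayed binder of the ladder only). Census-neutral: no σ, no seed, no census row is added or re-read; typed ≠ proved;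
machine ≠ kernel. No `sorry`, no `axiom`, no `instance`, no notation, no Literature fact; `decide` only in §4 on literal cells.

WHAT THE CENSUS SAYS (cited, not used as hypotheses). Row W32 (bc5-plan card v4.33 f70a4c715570b9ac; director R19.83 ∕ R19.88): on the
LINE-12 game the only REALISABLE fully-charged `N`-cell phase types are `(0,0,0,0)` and the antipodal `2+2` type `(0,0,2,2)` — rows
«m1» (no both-frame FC `N`-cell) and «tN:(0,0,0,2)» (no `3+1` antipodal FC `N`-cell) UNSAT on two encoders (gen3 kit j328208 + DRAT;
xres2s kit j328225 ∕ j328333 kissat + cadical + DRAT, drat-trim VERIFIED); W30: LINE-8 ∕ LINE-10 carry no odd FC cell at all (kit j326579,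
×2); the LINE-12 designs (1 585 cells 2b2cb5b4f83bccf4, kit j326579; 768 cells 1beef026ebdf95b9, kit j326935 — Cert12) carry ODD, BOTH-FRAME
FC `P`-cells (§4: `cert12OddP`), so the law below is an `N`-level law and the `N`∕`P` asymmetry is real. Director R19.88 ordered the same two
rows at LINE-14 ∕ LINE-16 («W-LINE-MENU-14-16», g56 gen3 ⊕ g28 xres2s).

CONTENT.
§0 verbatim copies of LINE 6's `LineSupport` ∕ `LineRealisable` ∕ `lineSupport_boostImage_iff` (own namespace `…LineRows`; the
   crux workfile `CeilingLineGame` is not an importable module on the farm; this file imports ONLY the tree module `Pad4TowerB1OddBoostBlind`).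
§1 `LineRowSAT h b τ` — «the row (level `b`, cell predicate `τ`) is SAT on the LINE-h game»: some `τ`-cell is LINE-realisable at height `h`
   (`CeilingLine.LineRealisable`, LINE 6). KERNEL: **`lineRealisable_boost`**, **`lineRowSAT_step`** — a boost-stable row that is SAT at `h` is
   SAT at `h + 2` (the `+2I` boost of the realising support: tree `staticH1BoostInvariant_holds`, `inDiamond_boostImage_two`, LINE 6
   `lineSupport_boostImage_iff`); contrapositive **`lineRowUNSAT_descends`** ∕ **`_iter`**: «UNSAT ROWS DESCEND» — an UNSAT verdict for a
   boost-stable row at LINE-(h+2n) is an UNSAT verdict at LINE-h. READING FOR THE MENU JOB (a consequence of the kernel lemma, not an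
   instruction): for the boost-stable rows m1 and tN:(0,0,0,2), UNSAT at 16 implies UNSAT at 14 (and re-implies 12); only a SAT at 16 makes the
   LINE-14 rows informative.
   + `lineRowSAT_ascends_iter` (SAT heights = UP-SET) and `lineRow_threshold`; §3b `lineRow_realiser_floorAnchored` (UNSAT at h−2 ⇒ every LINE-h realiser is FLOOR-ANCHORED) (UNSAT@h₀ ∧ SAT@(h₀+2) decide all heights of that parity).
§2 boost-stable cell predicates read off `β` only (`boostPt_snd`): `UniFrame` (pattern weight 0 or 4: all four letters in one frame),
   `negCount` ∕ `EvenSplit` (not a `3+1` antipodal split), `NMenu := FCc → UniFrame ∧ EvenSplit`; their boost-invariance.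
§3 **`LineNMenuLaw h : Prop`** — THE TYPED TARGET `(NM_h)`: every fully-charged `N`-cell of an H₁-static `G₁`-closed LINE-h support inside
   `◇_h` is uni-frame with an even antipodal split (phase type `(0,0,0,0)` or `(0,0,2,2)` up to `G₁`). Proved for NO `h` here. KERNEL:
   **`lineNMenuLaw_antitone`** `(NM_{h+2}) → (NM_h)` and `lineNMenuLaw_iff_rowUNSAT`. Its `h = 12` instance is exactly what rows m1 ⊕ tN say
   (machine ×2, DRAT; NOT a proof of `LineNMenuLaw 12`).
§4 `decide` probes: the Cert12 design's odd FC `P`-cell `P[10I+2ℓ₋₁ ∣ (11I+ℓ_i)³]` is fully charged, both-frame (not `UniFrame`), on the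
   line 12 and in `◇₁₂`; the `3+1` cell `N[(11I+ℓ₁)³ ∣ 11I+ℓ₋₁]` is uni-frame with `negCount = 1` (fails `EvenSplit`); `(0,0,2,2)` passes `NMenu`.

MECHANISM NOTE (why `(NM_h)` should be an `X⁺` statement; owed, not typed as a claim). On a line support RULE D at a fully charged cell is
PHASE-BLIND (LINE 6 kernel normal forms `ruleDN_line_fc_iff_drops`, `ruleDP_ceiling_iff_lifts`: drops ∕ lifts along the own rays only) and
`A2I⁻` is vacuous (`a2iMinusClosed_of_lineSupport`); the only phase-sensitive static family left is `X⁺`, which on a line fires only under an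
APEX parent (LINE 6 `xPlus_parent_apex_of_lineSupport`). Hence any proof of `(NM_h)` is a statement about `X⁺`-rivalry of `P`-children under
apex `N`-parents — consistent with W30's minimal cores at LINE-8∕10 («RULE-D + {X⁺}», X⁺ NEEDED). The all-`h` proof is OWED.
-/

set_option linter.dupNamespace false

namespace Summit.HodgeConjecture.HodgeConjecture.Cruxes.BlochSeedDiscOne.LineRows

open Summit.Ventures.HSemireg Summit.Ventures.HSemireg.Pad4Tower

/-! ## §0 The line sub-game (VERBATIM copies of LINE 6 `CeilingLine.LineSupport` ∕ `LineRealisable` ∕ `lineSupport_boostImage_iff`;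
that crux workfile is not an importable farm module, so — as `ThinnessTarget.lean` does — the three declarations are spelled out here, textually
identical, in this file's own namespace) -/

/-- **LINE SUPPORT of height `h`** (= LINE 6 `CeilingLine.LineSupport`, verbatim): every letter of every present cell lies on `α + c = h`. -/
abbrev LineSupport (h : ℤ) (C : MConfig) : Prop :=
  (∀ Z ∈ C.lower, ∀ f, OnCeiling h (Z f)) ∧ ∀ P ∈ C.upper, ∀ f, OnCeiling h (P f)

/-- **LINE-REALISABLE cell** (= LINE 6 `CeilingLine.LineRealisable`, verbatim): it lies on some H₁-static `G₁`-closed LINE support of `◇_h`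
(lower level iff `lowerLevel`). -/
def LineRealisable (h : ℤ) (lowerLevel : Bool) (Z : MCell) : Prop :=
  ∃ C : MConfig, C.InDiamond h ∧ LineSupport h C ∧ C.G1Closed ∧ C.StaticH1 ∧ (if lowerLevel then Z ∈ C.lower else Z ∈ C.upper)

/-- line-realisable cells are realisable (tree `CellRealisable`). -/
theorem cellRealisable_of_lineRealisable {h : ℤ} {b : Bool} {Z : MCell} (H : LineRealisable h b Z) : CellRealisable h b Z := by
  obtain ⟨C, hU, -, hG, hS, hZ⟩ := H
  exact ⟨C, hU, hG, hS, hZ⟩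

/-- the boost by `s` carries the ceiling line of height `h` onto the one of height `h + s` (= LINE 6, verbatim). -/
theorem onCeiling_boostPt_iff (h s : ℤ) (x : BPoint) : OnCeiling (h + s) (boostPt s x) ↔ OnCeiling h x := by
  obtain ⟨a, b1, b2⟩ := x
  simp only [OnCeiling, absCharge, chargeOf]
  omega

/-- line supports boost to line supports (= LINE 6, verbatim). -/
theorem lineSupport_boostImage_iff (h s : ℤ) (C : MConfig) : LineSupport (h + s) (C.boostImage s) ↔ LineSupport h C := by
  constructor
  · rintro ⟨hl, hu⟩
    refine ⟨fun Z hZ f => ?_, fun P hP f => ?_⟩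
    · have := hl (Z.boost s) (Finset.mem_image_of_mem _ hZ) f
      exact (onCeiling_boostPt_iff h s (Z f)).mp this
    · have := hu (P.boost s) (Finset.mem_image_of_mem _ hP) f
      exact (onCeiling_boostPt_iff h s (P f)).mp this
  · rintro ⟨hl, hu⟩
    refine ⟨fun W hW f => ?_, fun W hW f => ?_⟩
    · obtain ⟨Z, hZ, rfl⟩ := Finset.mem_image.mp hW
      exact (onCeiling_boostPt_iff h s (Z f)).mpr (hl Z hZ f)
    · obtain ⟨P, hP, rfl⟩ := Finset.mem_image.mp hW
      exact (onCeiling_boostPt_iff h s (P f)).mpr (hu P hP f)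

/-! ## §1 Rows of the line game and their descent -/

/-- **the row `(b, τ)` is SAT on the LINE-h game**: some cell satisfying `τ` is LINE-realisable at height `h` on level `b`
(`lowerLevel = true` ↔ `N`). -/
def LineRowSAT (h : ℤ) (b : Bool) (τ : MCell → Prop) : Prop := ∃ Z : MCell, τ Z ∧ LineRealisable h b Z

/-- **`LineReal_h + 2I ⊆ LineReal_{h+2}`** (kernel): the `+2` boost of a LINE-realisable cell is LINE-realisable two rungs up — the realising
support boosts to an H₁-static `G₁`-closed LINE-(h+2) support (`staticH1BoostInvariant_holds`, `lineSupport_boostImage_iff`). -/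
theorem lineRealisable_boost {h : ℤ} {b : Bool} {Z : MCell} (H : LineRealisable h b Z) : LineRealisable (h + 2) b (Z.boost 2) := by
  obtain ⟨C, hU, hL, hG, hS, hZ⟩ := H
  have hU' := inDiamond_boostImage_two hU
  obtain ⟨hSi, hGi, -⟩ := staticH1BoostInvariant_holds 2 C (inCone_of_inDiamond' hU) (inCone_of_inDiamond' hU')
  refine ⟨C.boostImage 2, hU', (lineSupport_boostImage_iff h 2 C).mpr hL, hGi.mp hG, hSi.mp hS, ?_⟩
  cases b
  · simp only [Bool.false_eq_true, ↓reduceIte] at hZ ⊢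
    exact Finset.mem_image_of_mem _ hZ
  · simp only [↓reduceIte] at hZ ⊢
    exact Finset.mem_image_of_mem _ hZ

/-- iterated: `LineReal_h + 2nI ⊆ LineReal_{h+2n}`. -/
theorem lineRealisable_translate {h : ℤ} {b : Bool} {Z : MCell} (H : LineRealisable h b Z) (n : ℕ) :
    LineRealisable (h + 2 * n) b (Z.boost (2 * n)) := by
  induction n with
  | zero => simpa [boost_zero] using H
  | succ n ih =>
    have := lineRealisable_boost ih
    rw [boost_boost] at this
    have e1 : h + 2 * (n : ℤ) + 2 = h + 2 * ((n + 1 : ℕ) : ℤ) := by push_cast; ring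
    have e2 : 2 * (n : ℤ) + 2 = 2 * ((n + 1 : ℕ) : ℤ) := by push_cast; ring
    rw [e1, e2] at this
    exact this

/-- **a BOOST-STABLE row that is SAT at LINE-h is SAT at LINE-(h+2)** (kernel). -/
theorem lineRowSAT_step {h : ℤ} {b : Bool} {τ : MCell → Prop} (hτ : ∀ Z, τ Z → τ (Z.boost 2)) (H : LineRowSAT h b τ) :
    LineRowSAT (h + 2) b τ := by
  obtain ⟨Z, hZ, hR⟩ := H
  exact ⟨Z.boost 2, hτ Z hZ, lineRealisable_boost hR⟩

/-- **«UNSAT ROWS DESCEND»** (kernel): an UNSAT verdict for a boost-stable row at LINE-(h+2) is an UNSAT verdict at LINE-h. -/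
theorem lineRowUNSAT_descends {h : ℤ} {b : Bool} {τ : MCell → Prop} (hτ : ∀ Z, τ Z → τ (Z.boost 2))
    (H : ¬ LineRowSAT (h + 2) b τ) : ¬ LineRowSAT h b τ := fun H' => H (lineRowSAT_step hτ H')

/-- iterated: UNSAT at LINE-(h+2n) ⇒ UNSAT at LINE-h — the UNSAT heights of a boost-stable row form a DOWN-SET in steps of two. -/
theorem lineRowUNSAT_descends_iter {h : ℤ} {b : Bool} {τ : MCell → Prop} (hτ : ∀ Z, τ Z → τ (Z.boost 2)) (n : ℕ)
    (H : ¬ LineRowSAT (h + 2 * n) b τ) : ¬ LineRowSAT h b τ := by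
  induction n generalizing h with
  | zero => simpa using H
  | succ n ih =>
    apply ih
    apply lineRowUNSAT_descends hτ
    have e : h + 2 * (n : ℤ) + 2 = h + 2 * ((n + 1 : ℕ) : ℤ) := by push_cast; ring
    rw [e]; exact H

/-- **«SAT ROWS ASCEND»** (kernel, the contrapositive face): SAT at LINE-h ⇒ SAT at LINE-(h+2n) — the SAT heights of a boost-stable row form
an UP-SET in steps of two; so ONE SAT height decides every higher height of the same parity (the converter that turns «no menu row is excluded
at LINE 16» (machine, ×1, j328717) into the same reading at every even `h ≥ 16`). -/
theorem lineRowSAT_ascends_iter {h : ℤ} {b : Bool} {τ : MCell → Prop} (hτ : ∀ Z, τ Z → τ (Z.boost 2)) (n : ℕ)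
    (H : LineRowSAT h b τ) : LineRowSAT (h + 2 * n) b τ := by
  induction n with
  | zero => simpa using H
  | succ n ih =>
    have e : h + 2 * ((n + 1 : ℕ) : ℤ) = h + 2 * (n : ℤ) + 2 := by push_cast; ring
    rw [e]; exact lineRowSAT_step hτ ih

/-- **EXACT THRESHOLD FORM** (kernel): if a boost-stable row is UNSAT at LINE-h₀ and SAT at LINE-(h₀+2), then it is UNSAT at every
`h₀ - 2n` and SAT at every `h₀ + 2 + 2n` — two verdicts at consecutive heights decide the row at all heights of that parity
(reading for rows m1 ∕ tN:(0,0,0,2) ∕ oddN with h₀ = 12: W32 UNSAT@12 ×2, j328717 SAT@14 ×1). -/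
theorem lineRow_threshold {h₀ : ℤ} {b : Bool} {τ : MCell → Prop} (hτ : ∀ Z, τ Z → τ (Z.boost 2))
    (hU : ¬ LineRowSAT h₀ b τ) (hS : LineRowSAT (h₀ + 2) b τ) (n : ℕ) :
    ¬ LineRowSAT (h₀ - 2 * n) b τ ∧ LineRowSAT (h₀ + 2 + 2 * n) b τ := by
  refine ⟨lineRowUNSAT_descends_iter hτ n ?_, lineRowSAT_ascends_iter hτ n hS⟩
  have e : h₀ - 2 * (n : ℤ) + 2 * n = h₀ := by ring
  rw [e]; exact hU

/-! ## §2 Boost-stable cell predicates read off `β` (frames and antipodal splits) -/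

/-- the letter lies in the REAL frame (`β = ±c`, `c ≥ 1`). -/
abbrev RealAx (x : BPoint) : Prop := x.2.1 ≠ 0 ∧ x.2.2 = 0
/-- the letter lies in the IMAGINARY frame (`β = ±c·i`). -/
abbrev ImAx (x : BPoint) : Prop := x.2.1 = 0 ∧ x.2.2 ≠ 0
/-- **UNI-FRAME cell**: all four letters in the real frame, or all four in the imaginary frame (pattern weight `0` or `4`). Decidable. -/
abbrev UniFrame (Z : MCell) : Prop := (∀ f, RealAx (Z f)) ∨ ∀ f, ImAx (Z f)
/-- the letter is on the NEGATIVE half of its frame (`β = −c` or `β = −c·i`). -/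
abbrev NegHalf (x : BPoint) : Prop := x.2.1 < 0 ∨ x.2.2 < 0
/-- number of letters on the negative half (for a uni-frame cell: the size of one side of the antipodal split). -/
abbrev negCount (Z : MCell) : ℕ := (Finset.univ.filter fun f : Fin 4 => NegHalf (Z f)).card
/-- **EVEN SPLIT**: not a `3+1` antipodal split (`negCount ∉ {1, 3}`; the `2+2` type `(0,0,2,2)` and the pure types pass). Decidable. -/
abbrev EvenSplit (Z : MCell) : Prop := negCount Z ≠ 1 ∧ negCount Z ≠ 3
/-- **the `N`-MENU predicate**: a fully charged cell is uni-frame with an even split (phase type `(0,0,0,0)` or `(0,0,2,2)` up to `G₁`). -/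
abbrev NMenu (Z : MCell) : Prop := FCc Z → UniFrame Z ∧ EvenSplit Z

/-- the boost does not touch `β`. -/
theorem boost_snd (s : ℤ) (Z : MCell) (f : Fin 4) : (Z.boost s f).2 = (Z f).2 := rfl
theorem fcc_boost_iff (s : ℤ) (Z : MCell) : FCc (Z.boost s) ↔ FCc Z := Iff.rfl
theorem uniFrame_boost_iff (s : ℤ) (Z : MCell) : UniFrame (Z.boost s) ↔ UniFrame Z := Iff.rfl
theorem negCount_boost (s : ℤ) (Z : MCell) : negCount (Z.boost s) = negCount Z := rfl
theorem evenSplit_boost_iff (s : ℤ) (Z : MCell) : EvenSplit (Z.boost s) ↔ EvenSplit Z := Iff.rfl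
theorem nMenu_boost_iff (s : ℤ) (Z : MCell) : NMenu (Z.boost s) ↔ NMenu Z := Iff.rfl

/-! ## §3 The typed target `(NM_h)` and its descent -/

/-- **`(NM_h)` THE LINE `N`-MENU LAW — TARGET, proved for no `h` here.** Every fully-charged `N`-cell of an H₁-static, `G₁`-closed LINE-h
support inside `◇_h` is uni-frame with an even antipodal split. (`h = 12`: census rows m1 ⊕ tN:(0,0,0,2) UNSAT ×2 with DRAT — machine, not
kernel.) -/
def LineNMenuLaw (h : ℤ) : Prop :=
  ∀ C : MConfig, C.InDiamond h → LineSupport h C → C.G1Closed → C.StaticH1 → ∀ Z ∈ C.lower, NMenu Z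

/-- `(NM_h)` ⟺ the row «an `N`-cell violating the menu» is UNSAT on the LINE-h game. -/
theorem lineNMenuLaw_iff_rowUNSAT (h : ℤ) : LineNMenuLaw h ↔ ¬ LineRowSAT h true (fun Z => ¬ NMenu Z) := by
  constructor
  · rintro H ⟨Z, hZ, C, hU, hL, hG, hS, hZC⟩
    simp only [↓reduceIte] at hZC
    exact hZ (H C hU hL hG hS Z hZC)
  · intro H C hU hL hG hS Z hZC
    by_contra hZ
    exact H ⟨Z, hZ, C, hU, hL, hG, hS, by simpa using hZC⟩

/-- **`(NM_{h+2}) → (NM_h)`** (kernel): the heights at which the `N`-menu law holds form a DOWN-SET in steps of two. -/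
theorem lineNMenuLaw_antitone {h : ℤ} (H : LineNMenuLaw (h + 2)) : LineNMenuLaw h := by
  rw [lineNMenuLaw_iff_rowUNSAT] at H ⊢
  exact lineRowUNSAT_descends (fun Z hZ => by rwa [nMenu_boost_iff]) H

/-- iterated. -/
theorem lineNMenuLaw_antitone_iter {h : ℤ} (n : ℕ) (H : LineNMenuLaw (h + 2 * n)) : LineNMenuLaw h := by
  rw [lineNMenuLaw_iff_rowUNSAT] at H ⊢
  exact lineRowUNSAT_descends_iter (fun Z hZ => by rwa [nMenu_boost_iff]) n H

/-- the two rows of record are boost-stable, so their UNSAT verdicts descend (kernel; apply to the machine rows as READINGS only). -/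
theorem bothFrame_row_descends {h : ℤ} (n : ℕ) (H : ¬ LineRowSAT (h + 2 * n) true (fun Z => FCc Z ∧ ¬ UniFrame Z)) :
    ¬ LineRowSAT h true (fun Z => FCc Z ∧ ¬ UniFrame Z) := lineRowUNSAT_descends_iter (fun _ hZ => hZ) n H

theorem threeOne_row_descends {h : ℤ} (n : ℕ) (H : ¬ LineRowSAT (h + 2 * n) true (fun Z => FCc Z ∧ UniFrame Z ∧ ¬ EvenSplit Z)) :
    ¬ LineRowSAT h true (fun Z => FCc Z ∧ UniFrame Z ∧ ¬ EvenSplit Z) := lineRowUNSAT_descends_iter (fun _ hZ => hZ) n H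

/-- the contrapositive face for the typed target: a failure of `(NM_h)` climbs — `¬ (NM_h) → ¬ (NM_{h+2n})` (reading: j328717's LINE-14 models
for rows m1 ∕ tN:(0,0,0,2), ×1, would make `(NM_h)` false for every even `h ≥ 14`, while W32 ×2 makes it true for every even `h ≤ 12`). -/
theorem not_lineNMenuLaw_ascends_iter {h : ℤ} (n : ℕ) (H : ¬ LineNMenuLaw h) : ¬ LineNMenuLaw (h + 2 * n) :=
  fun H' => H (lineNMenuLaw_antitone_iter n H')

/-! ## §3b THRESHOLD EXTREMALITY ON THE LINE (kernel; the row-level form of tree §8 `threshold_support_spans`)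
If a row is UNSAT at LINE-(h−2), then at LINE-h every realising support is FLOOR-ANCHORED (some letter on the floor `α = c`):
otherwise its boost by `−2I` is a LINE-(h−2) realiser. Reading (machine inputs): the LINE-14 realisations of rows m1 ∕ tN:(0,0,0,2) ∕ oddN
(j328717, ×1) must reach the floor letters `7ℓ_u` given W32 (×2) — the LINE-12 exclusion is a DEPTH BUDGET, not a local law. -/

/-- **row threshold ⇒ floor-anchored realisers** (kernel). `τ` must be stable under the downward boost (every β-only row is). -/
theorem lineRow_realiser_floorAnchored {h : ℤ} {b : Bool} {τ : MCell → Prop} (hτ : ∀ Z, τ Z → τ (Z.boost (-2)))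
    (hU : ¬ LineRowSAT (h - 2) b τ) {C : MConfig} (hD : C.InDiamond h) (hL : LineSupport h C) (hG : C.G1Closed)
    (hS : C.StaticH1) {Z : MCell} (hZτ : τ Z) (hZ : if b then Z ∈ C.lower else Z ∈ C.upper) : C.FloorAnchored := by
  by_contra hA
  have hdia : ∀ W, (W ∈ C.lower ∨ W ∈ C.upper) → ∀ f, InDiamond h (W f) := fun W hW f =>
    hW.elim (fun hW => hD.1 W hW f) (fun hW => hD.2 W hW f)
  have key : ∀ W, (W ∈ C.lower ∨ W ∈ C.upper) → ∀ f, InDiamond (h - 2) (boostPt (-2) (W f)) := by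
    intro W hW f
    have hx := hdia W hW f
    have hnf : ¬ ((W f).1 = absCharge (W f)) := fun hfl =>
      hA (hW.elim (fun hW => Or.inl ⟨W, hW, f, hfl⟩) (fun hW => Or.inr ⟨W, hW, f, hfl⟩))
    have h1 := hx.2.1
    have h2 := hx.2.2.1
    have h3 := hx.2.2.2
    exact inDiamond_boostPt hx (by omega) (by omega) (by omega)
  have hD' : (C.boostImage (-2)).InDiamond (h - 2) := by
    constructor
    · intro W hW f
      obtain ⟨Z, hZ, rfl⟩ := Finset.mem_image.mp hW
      exact key Z (Or.inl hZ) f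
    · intro W hW f
      obtain ⟨Z, hZ, rfl⟩ := Finset.mem_image.mp hW
      exact key Z (Or.inr hZ) f
  have hL' : LineSupport (h - 2) (C.boostImage (-2)) := by
    have e : h - 2 = (h - 2 + 2) + (-2) := by ring
    rw [e, lineSupport_boostImage_iff]
    have e' : h - 2 + 2 = h := by ring
    rw [e']; exact hL
  obtain ⟨hSi, hGi, -⟩ := staticH1BoostInvariant_holds (-2) C (inCone_of_inDiamond' hD) (inCone_of_inDiamond' hD')
  have hZ' : if b then Z.boost (-2) ∈ (C.boostImage (-2)).lower else Z.boost (-2) ∈ (C.boostImage (-2)).upper := by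
    cases b
    · simp only [Bool.false_eq_true, ↓reduceIte] at hZ ⊢; exact Finset.mem_image_of_mem _ hZ
    · simp only [↓reduceIte] at hZ ⊢; exact Finset.mem_image_of_mem _ hZ
  exact hU ⟨Z.boost (-2), hτ Z hZτ, C.boostImage (-2), hD', hL', hGi.mp hG, hSi.mp hS, hZ'⟩

/-- the `(NM)` instance: given `(NM_{h−2})`, every LINE-h static `G₁`-closed support in `◇_h` carrying an FC `N`-cell that is both-frame or
odd-split is FLOOR-ANCHORED (reading: h = 14 with W32). -/
theorem lineNMenu_violator_floorAnchored {h : ℤ} (H : LineNMenuLaw (h - 2)) {C : MConfig} (hD : C.InDiamond h) (hL : LineSupport h C)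
    (hG : C.G1Closed) (hS : C.StaticH1) {Z : MCell} (hZ : Z ∈ C.lower) (hv : ¬ NMenu Z) : C.FloorAnchored := by
  rw [lineNMenuLaw_iff_rowUNSAT] at H
  exact lineRow_realiser_floorAnchored (b := true) (τ := fun Z => ¬ NMenu Z) (fun Z hZ => by rwa [nMenu_boost_iff]) H hD hL hG hS hv
    (by simpa using hZ)

/-! ## §4 `decide` probes on literal cells (conventions: `mcellOf (α, Re β, Im β) …`; `ℓ_i ↦ Im β ≠ 0`) -/

/-- the Cert12 design's odd FC `P`-cell `P[10I+2ℓ₋₁ ∣ (11I+ℓ_i)³]` (768-cell LINE-12 design 1beef026ebdf95b9, DataP chunk literal). -/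
def cert12OddP : MCell := mcellOf (10, -2, 0) (11, 0, 1) (11, 0, 1) (11, 0, 1)
/-- a `3+1` antipodal uni-frame cell `[(11I+ℓ₁)³ ∣ 11I+ℓ₋₁]` (row tN:(0,0,0,2)'s shape at depth 1). -/
def threeOneCell : MCell := mcellOf (11, 1, 0) (11, 1, 0) (11, 1, 0) (11, -1, 0)
/-- the `2+2` antipodal cell `[(11I+ℓ₁)² ∣ (11I+ℓ₋₁)²]` (type `(0,0,2,2)`, realisable at LINE-12 per W32). -/
def twoTwoCell : MCell := mcellOf (11, 1, 0) (11, 1, 0) (11, -1, 0) (11, -1, 0)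

theorem cert12OddP_probe : FCc cert12OddP ∧ ¬ UniFrame cert12OddP ∧ ¬ NMenu cert12OddP := by decide
theorem cert12OddP_line : (∀ f, OnCeiling 12 (cert12OddP f)) ∧ ∀ f, InDiamond 12 (cert12OddP f) := by decide
theorem threeOneCell_probe : FCc threeOneCell ∧ UniFrame threeOneCell ∧ negCount threeOneCell = 1 ∧ ¬ NMenu threeOneCell := by decide
theorem twoTwoCell_probe : FCc twoTwoCell ∧ UniFrame twoTwoCell ∧ negCount twoTwoCell = 2 ∧ NMenu twoTwoCell := by decide

end Summit.HodgeConjecture.HodgeConjecture.Cruxes.BlochSeedDiscOne.LineRows
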